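import Summits.ResolutionOfSingularities.ResolutionOfSingularities.Theorems.EquisingularLiftEquisingularLiftNatNodalCurveCartier
import Summits.ResolutionOfSingularities.ResolutionOfSingularities.Theorems.EquisingularLiftEquisingularLiftNatModelSquareRegularStalk
import HarnessLib

/-!
# EL♮(3), WIDTH TABLE W₂ «Σ-SECTION ROUND» (desk R73/R73d), supply brick «(L2)-CARTIER»: a centre cut on the host by ONE PARAMETER is an EFFECTIVE CARTIER
# divisor of the host's reduced trace — `EmbeddedLiftFact`'s local-complete-intersection clause for `ι : Z̃ ⟶ Ẽ` from the letter (L2) and the host's REGULAR MODEL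

res-L1-w45b-nose-w1 g6 (WIDTH seat D-0157 DOOR 1; R73d owner of `TCPlus.hround_sec`, this is its new brick (A)).  The W₂ door (res-type-027
`…NatResidueHypDefs11`, (HR-SEC); res-L1-w45b-idea-2 `SIGMA-NFF-NOTE` §2) replaces «`Ẽ` regular along `Z̃`» by the letter (L2): at every closed `z ∈ Z`,
`𝓘⟨Z⟩_z = 𝓘⟨E⟩_z + (f)` with `f ∉ 𝓘⟨E⟩_z + 𝔪_z²`.  ✓ `embeddedLiftFact_holds` (p704265) then wants `Z̃ ⊆ Ẽ` to be a local complete intersection: an affine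
open neighbourhood of each point on which the ideal of `Z̃` is generated by a weakly regular sequence.  For the NODAL residue this was ✓ p696215
`NodalCurve.exists_affineOpens_isWeaklyRegular_ker` («a reduced curve on a REGULAR surface trace is Cartier»); here the host `Ẽ` is NOT regular at the
points that matter (two sheets crossing along a node fibre) and `𝒪_{Ẽ,z}` is not a domain, so the non-zero-divisor property of the generator `f̄` needs a
reason: THE HOST'S REGULAR MODEL.  Upstairs `Ẽ` is the special fibre of the regular `O`-flat `W = V(𝓔)` (model square `jW`); at `x = jW (ι z)` the local
ring `A = 𝒪_{W,x}` is regular of dimension `dim 𝒪_{Ẽ,ι z} + 1 = 3` ((D2) + ✓ `ModelSquare.ringKrullDim_stalk_eq_fibre_add_one`), a lift `f̃` of `f̄` is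
a regular PARAMETER (`f̃ ∉ 𝔪_A²` because `f̄ ∉ 𝔪̄²`), so `A ⧸ (f̃)` is a regular DOMAIN of dimension `2`, the uniformiser germ `ϖ̃` is not in `(f̃)` (else
`𝒪_{Z̃,z} ≅ A ⧸ (f̃)` would have dimension `2`, not `1` = (D1)), hence `(f̃, ϖ̃)` is a regular sequence, and swapping it in the domain `A` gives:
`f̄` is a NON-ZERO-DIVISOR of `A ⧸ (ϖ̃) ≅ 𝒪_{Ẽ,ι z}`.  (Equidimensionality of `Ẽ` at `z` — idea-2's route, STATUS 2026-08-29T08:01:52Z — is the same fact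
read downstairs; the model makes it free.)

* §1 ring lemmas: `ker_eq_map_ker_comp_of_surjective`, `isSMulRegular_of_span_singleton_eq`, `mem_span_of_mul_mem_span_swap` (the 2-line swap),
  `exists_notMem_forall_mul_eq_zero_of_isSMulRegular` (✓ p696215's spreading lemma with `[IsDomain]`/`j ≠ 0` replaced by `IsSMulRegular`).
* ★ `SecCurve.ker_stalkMap_eq_span_and_isSMulRegular` — at a closed point: the ideal of `ι : Z̃ ⟶ Ẽ` is `(f̄)`, `f̄ ∉ 𝔪²`, `f̄` a non-zero-divisor.
* ★★ `SecCurve.exists_affineOpens_isWeaklyRegular_ker` — `EmbeddedLiftFact`'s lci clause for `ι` VERBATIM in shape (closed points first, spreading of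
  generator and non-zero-divisor to a basic open as in ✓ p696215, generisation).

DEF-FREE; no `sorry`; standard axioms; `--supports stmt-ResolutionOfSingularities-20148 --as helper`, counted 0.  EL♮(3) is NOT proved; resolution of singularities
in positive characteristic is NOT proved anywhere in this tree (dim 3 in print: Cossart–Piltant 2008/2009); nothing of [Hironaka2017] is asserted.
References (method only): H. Matsumura, *Commutative Ring Theory* (1986), Thm. 14.2, §6 (associated primes).
-/

set_option linter.dupNamespace false -- mandated namespace `Summit.<Summit>.<Problem>` of this single-conjunct summit

noncomputable section

open CategoryTheory AlgebraicGeometry TopologicalSpace IsLocalRing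
open Literature.AlgebraicGeometry.Resolution
open AlgebraicGeometry.Scheme.IdealSheafData
open Summit.ResolutionOfSingularities.ResolutionOfSingularities.Cruxes.EquisingularLift.StrataSplit

namespace Summit.ResolutionOfSingularities.ResolutionOfSingularities.Cruxes.EquisingularLiftNat.Sections.SecCurve

open Summit.ResolutionOfSingularities.ResolutionOfSingularities.Cruxes.EquisingularLiftNat.Sections

universe u v

/-! ## §1 Ring lemmas -/

/-- For a surjection `g : A ↠ B` and `h : B → C`: `ker h = g (ker (h ∘ g))`. [folklore] -/
theorem ker_eq_map_ker_comp_of_surjective {A B C : Type*} [CommRing A] [CommRing B] [CommRing C] (g : A →+* B) (hg : Function.Surjective g)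
    (h : B →+* C) : RingHom.ker h = (RingHom.ker (h.comp g)).map g := by
  refine le_antisymm (fun b hb => ?_) ?_
  · obtain ⟨a, rfl⟩ := hg b
    exact Ideal.mem_map_of_mem g (show a ∈ RingHom.ker (h.comp g) from hb)
  · rw [Ideal.map_le_iff_le_comap]
    intro a ha
    exact ha

/-- A generator of the principal ideal of a regular element is regular. [folklore] -/
theorem isSMulRegular_of_span_singleton_eq {A : Type*} [CommRing A] {a b : A} (hb : IsSMulRegular A b)
    (h : Ideal.span {a} = Ideal.span {b}) : IsSMulRegular A a := by
  obtain ⟨u, hu⟩ := Ideal.mem_span_singleton'.mp (h ▸ Ideal.mem_span_singleton_self a : a ∈ Ideal.span {b})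
  obtain ⟨v, hv⟩ := Ideal.mem_span_singleton'.mp (h.symm ▸ Ideal.mem_span_singleton_self b : b ∈ Ideal.span {a})
  -- `b = v a = v u b`, so `b (1 - v u) = 0` and `v u = 1`
  have h1 : b • (1 - v * u) = b • (0 : A) := by
    rw [smul_eq_mul, smul_eq_mul, mul_sub, mul_one, mul_zero]
    have : b * (v * u) = b := by
      calc b * (v * u) = v * (u * b) := by ring
        _ = v * a := by rw [hu]
        _ = b := hv
    rw [this, sub_self]
  have hvu : v * u = 1 := by
    have := hb h1
    exact (sub_eq_zero.mp this).symm
  have huunit : IsUnit u := IsUnit.of_mul_eq_one v (by rw [mul_comm]; exact hvu)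
  rw [← hu]
  exact (huunit.isSMulRegular A).mul hb

/-- **The two-line swap**: in a domain `A`, if `f ≠ 0` and `ϖ` is a non-zero-divisor modulo `f`, then `f` is a non-zero-divisor modulo `ϖ`. [folklore] -/
theorem mem_span_of_mul_mem_span_swap {A : Type*} [CommRing A] [IsDomain A] {f ϖ : A} (hf : f ≠ 0)
    (hϖ : ∀ b : A, ϖ * b ∈ Ideal.span {f} → b ∈ Ideal.span {f}) (a : A) (ha : f * a ∈ Ideal.span {ϖ}) : a ∈ Ideal.span {ϖ} := by
  obtain ⟨b, hb⟩ := Ideal.mem_span_singleton'.mp ha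
  -- `b ϖ = f a`, so `ϖ b ∈ (f)` and `b = b' f`
  obtain ⟨b', hb'⟩ := Ideal.mem_span_singleton'.mp (hϖ b (Ideal.mem_span_singleton'.mpr ⟨a, by rw [mul_comm, ← hb, mul_comm]⟩))
  refine Ideal.mem_span_singleton'.mpr ⟨b', mul_left_cancel₀ hf ?_⟩
  calc f * (b' * ϖ) = b' * f * ϖ := by ring
    _ = b * ϖ := by rw [hb']
    _ = f * a := hb

/-- **Spreading a non-zero-divisor from the local ring** (✓ p696215 `NodalCurve.exists_notMem_forall_mul_eq_zero` with the domain hypothesis replaced by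
regularity): `R` Noetherian, `A = R_𝔮`, `j/1` a non-zero-divisor of `A`; then one `g ∉ 𝔮` kills every annihilator of `j`. [folklore] -/
theorem exists_notMem_forall_mul_eq_zero_of_isSMulRegular {R : Type u} [CommRing R] [IsNoetherianRing R] (q : Ideal R) [q.IsPrime]
    {A : Type v} [CommRing A] [Algebra R A] [IsLocalization.AtPrime A q] {j : R} (hj : IsSMulRegular A (algebraMap R A j)) :
    ∃ g ∉ q, ∀ a : R, a * j = 0 → g * a = 0 := by
  -- adapted from Summits/…/EquisingularLiftEquisingularLiftNatNodalCurveCartier.lean (res-L1-w45b-nose-w1 g5)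
  classical
  let K : Submodule R R := LinearMap.ker (LinearMap.mulRight R j)
  have hK : ∀ a : R, a ∈ K ↔ a * j = 0 := fun a => by
    simp only [K, LinearMap.mem_ker, LinearMap.mulRight_apply]
  obtain ⟨s, hs⟩ : K.FG := IsNoetherian.noetherian K
  have ht : ∀ a ∈ s, ∃ t : q.primeCompl, (t : R) * a = 0 := by
    intro a ha
    have haK : a ∈ K := hs ▸ Submodule.subset_span ha
    have haj : a * j = 0 := (hK a).mp haK
    have h0 : algebraMap R A a = 0 := by
      have h := congrArg (algebraMap R A) haj
      rw [map_mul, map_zero, mul_comm] at h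
      have h' : algebraMap R A j • algebraMap R A a = algebraMap R A j • (0 : A) := by rw [smul_eq_mul, smul_zero, h]
      exact hj h'
    exact (IsLocalization.map_eq_zero_iff q.primeCompl A a).mp h0
  choose! t ht using ht
  refine ⟨∏ a ∈ s, (t a : R), ?_, ?_⟩
  · have hmem : (∏ a ∈ s, (t a : R)) ∈ q.primeCompl := Submonoid.prod_mem _ fun a ha => (t a).2
    exact hmem
  · intro a haj
    have haK : a ∈ Submodule.span R (s : Set R) := hs.symm ▸ (hK a).mpr haj
    refine Submodule.span_induction (p := fun a _ => (∏ x ∈ s, (t x : R)) * a = 0) ?_ (by simp) ?_ ?_ haK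
    · intro x hxs
      obtain ⟨c, hc⟩ : (t x : R) ∣ ∏ y ∈ s, (t y : R) := Finset.dvd_prod_of_mem _ hxs
      rw [hc, mul_comm ((t x : R)) c, mul_assoc, ht x hxs, mul_zero]
    · intro x y _ _ hx hy
      rw [mul_add, hx, hy, add_zero]
    · intro c x _ hx
      rw [smul_eq_mul, mul_left_comm, hx, mul_zero]

/-! ## §2 At a closed point: the ideal of `Z̃` in `Ẽ` is generated by ONE parameter which is a non-zero-divisor -/

section Stalk

variable (O : Type) [CommRing O] [IsDomain O] [IsDiscreteValuationRing O] {k : Type} [Field k] (θ : O →+* k) (hθ : Function.Surjective θ)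
  {G : Scheme.{0}} {Z E : Set G} (hZ : IsClosed Z) (hE : IsClosed E)
  -- the host's regular model `W` over `O`, with special fibre `Ẽ` (model square `jW`)
  {W : Scheme.{0}} (w : W ⟶ Spec (.of O)) (jW : redSub G E hE ⟶ W) (tW : redSub G E hE ⟶ Spec (.of k))
  (hsqW : IsPullback jW tW w (Spec.map (CommRingCat.ofHom θ)))

include hθ hsqW in
/-- ★ **At a point of `Z̃` (used at CLOSED points): the kernel of `𝒪_{Ẽ,i z} ↠ 𝒪_{Z̃,z}` for `i : Z̃ ⟶ Ẽ` (`i ≫ ι_E = ι_Z`) is `(f̄)` with `f̄ ∈ 𝔪 ∖ 𝔪²` a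
NON-ZERO-DIVISOR of `𝒪_{Ẽ,i z}`.**  Inputs: the host's regular `O`-flat model `W` (model square `jW`, `W` locally Noetherian), (D1) `dim 𝒪_{Z̃,z} = 1`,
(D2) `dim 𝒪_{Ẽ,i z} = 2`, and (L2) at the image point of `G`.  See the module docstring for the argument through the regular parameter `f̃` of
`𝒪_{W, jW (i z)}`. [folklore; Matsumura 14.2 + the swap] [OURS · W₂ brick (A); counted 0] -/
theorem ker_stalkMap_eq_span_and_isSMulRegular [IsLocallyNoetherian W] [Flat w] (hWreg : Scheme.IsRegular W)
    (i : redSub G Z hZ ⟶ redSub G E hE) (hi : i ≫ redSubι G E hE = redSubι G Z hZ) (z : ↥(redSub G Z hZ))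
    (hZdim : ringKrullDim ((redSub G Z hZ).presheaf.stalk z) = ((1 : ℕ) : WithBot ℕ∞))
    (hEdim : ringKrullDim ((redSub G E hE).presheaf.stalk (i z)) = ((2 : ℕ) : WithBot ℕ∞))
    (hL2 : ∃ f : G.presheaf.stalk ((redSubι G Z hZ) z),
      stalkIdeal (vanishingIdeal (⟨Z, hZ⟩ : Closeds G)) ((redSubι G Z hZ) z) =
          stalkIdeal (vanishingIdeal (⟨E, hE⟩ : Closeds G)) ((redSubι G Z hZ) z) ⊔ Ideal.span {f} ∧
        f ∉ stalkIdeal (vanishingIdeal (⟨E, hE⟩ : Closeds G)) ((redSubι G Z hZ) z) ⊔ maximalIdeal (G.presheaf.stalk ((redSubι G Z hZ) z)) ^ 2) :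
    ∃ fb : (redSub G E hE).presheaf.stalk (i z),
      RingHom.ker (i.stalkMap z).hom = Ideal.span {fb} ∧
      fb ∈ maximalIdeal ((redSub G E hE).presheaf.stalk (i z)) ∧
      fb ∉ maximalIdeal ((redSub G E hE).presheaf.stalk (i z)) ^ 2 ∧
      IsSMulRegular ((redSub G E hE).presheaf.stalk (i z)) fb := by
  set ι : redSub G Z hZ ⟶ redSub G E hE := i with hι
  have hιfac : ι ≫ redSubι G E hE = redSubι G Z hZ := hi
  -- the point downstairs and the two stalk maps `πE : 𝒪_{G,z₀} ↠ 𝒪_{Ẽ,ι z}`, `πι : 𝒪_{Ẽ,ι z} ↠ 𝒪_{Z̃,z}`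
  set y := ι z with hy
  have hz₀ : (redSubι G E hE) y = (redSubι G Z hZ) z := by
    rw [hy, ← Scheme.Hom.comp_apply, hιfac]
  set B := (redSub G E hE).presheaf.stalk y with hB
  set πE : G.presheaf.stalk ((redSubι G E hE) y) →+* B := ((redSubι G E hE).stalkMap y).hom with hπE
  have hπEsurj : Function.Surjective πE := (redSubι G E hE).stalkMap_surjective y
  have hkerE : RingHom.ker πE = stalkIdeal (vanishingIdeal (⟨E, hE⟩ : Closeds G)) ((redSubι G E hE) y) := by
    rw [hπE, ← stalkIdeal_ker_eq_ker_stalkMap, ker_subschemeι]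
  set πι : B →+* (redSub G Z hZ).presheaf.stalk z := (ι.stalkMap z).hom with hπι
  haveI : IsClosedImmersion (ι ≫ redSubι G E hE) := by rw [hιfac]; infer_instance
  haveI : IsClosedImmersion ι := IsClosedImmersion.of_comp_isClosedImmersion ι (redSubι G E hE)
  have hπιsurj : Function.Surjective πι := ι.stalkMap_surjective z
  -- `ker (πι ∘ πE) = 𝓘⟨Z⟩_{z₀}`
  have hcomp : πι.comp πE = ((ι ≫ redSubι G E hE).stalkMap z).hom := by
    rw [hπι, hπE, Scheme.Hom.stalkMap_comp]; rfl
  have hkerZ : RingHom.ker (πι.comp πE) = stalkIdeal (vanishingIdeal (⟨Z, hZ⟩ : Closeds G)) ((redSubι G E hE) y) := by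
    have h1 : stalkIdeal (ι ≫ redSubι G E hE).ker ((ι ≫ redSubι G E hE) z) = RingHom.ker (((ι ≫ redSubι G E hE).stalkMap z).hom) :=
      stalkIdeal_ker_eq_ker_stalkMap _ z
    have hk : (ι ≫ redSubι G E hE).ker = vanishingIdeal (⟨Z, hZ⟩ : Closeds G) := by rw [hιfac, ker_subschemeι]
    rw [hk] at h1
    rw [hcomp]
    exact h1.symm
  -- read (L2) at `z₀ = ι_E y`
  rw [← hz₀] at hL2
  obtain ⟨f, hf, hf2⟩ := hL2
  refine ⟨πE f, ?_, ?_, ?_, ?_⟩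
  · -- (a) the generator
    rw [ker_eq_map_ker_comp_of_surjective πE hπEsurj πι, hkerZ, hf, Ideal.map_sup, ← hkerE, Ideal.map_span, Set.image_singleton]
    rw [(Ideal.map_eq_bot_iff_le_ker πE).mpr le_rfl, bot_sup_eq]
  · -- `f̄ ∈ 𝔪`: `𝓘⟨Z⟩_{z₀} ≤ 𝔪`
    have hzZ : (redSubι G E hE) y ∈ (((vanishingIdeal (⟨Z, hZ⟩ : Closeds G)) : G.IdealSheafData).support : Set G) := by
      rw [hz₀, ← Scheme.IdealSheafData.range_subschemeι]; exact ⟨z, rfl⟩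
    have hfm : f ∈ maximalIdeal (G.presheaf.stalk ((redSubι G E hE) y)) :=
      (mem_support_iff_stalkIdeal_le _ _).mp hzZ (hf ▸ Ideal.mem_sup_right (Ideal.mem_span_singleton_self f))
    rw [← IsLocalRing.map_maximalIdeal_of_surjective πE hπEsurj]
    exact Ideal.mem_map_of_mem _ hfm
  · -- (b) `f̄ ∉ 𝔪²`
    intro h2
    apply hf2
    rw [← IsLocalRing.map_maximalIdeal_of_surjective πE hπEsurj, ← Ideal.map_pow] at h2
    have h3 := Ideal.mem_comap.mpr h2
    rw [Ideal.comap_map_of_surjective πE hπEsurj, ← RingHom.ker_eq_comap_bot, hkerE, sup_comm] at h3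
    exact h3
  · -- (c) NON-ZERO-DIVISOR, through the regular model `W`
    haveI : IsClosedImmersion (Spec.map (CommRingCat.ofHom θ)) := IsClosedImmersion.spec_of_surjective _ hθ
    set A := W.presheaf.stalk (jW y) with hA
    haveI : IsRegularLocalRing A := hWreg _
    obtain ⟨ϖ, hϖ⟩ := IsDiscreteValuationRing.exists_irreducible O
    set ϖb : A := (W.presheaf.Γgerm (jW y)).hom (w.appTop.hom ((Scheme.ΓSpecIso (.of O)).inv.hom ϖ)) with hϖb
    set πW : A →+* B := (jW.stalkMap y).hom with hπW
    have hπWsurj : Function.Surjective πW := stalkMap_model_surjective θ hθ w jW tW hsqW y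
    have hkerW : RingHom.ker πW = Ideal.span {ϖb} := ModelSquare.ker_stalkMap_eq_span_germ O θ hθ w jW tW hsqW y ϖ hϖ
    have hdimA : ringKrullDim A = ringKrullDim B + 1 := ModelSquare.ringKrullDim_stalk_eq_fibre_add_one O θ hθ w jW tW hsqW y
    -- a lift `f̃` of `f̄`, a regular parameter of `A`
    obtain ⟨ft, hft⟩ := hπWsurj (πE f)
    have hmapW : (maximalIdeal A).map πW = maximalIdeal B := IsLocalRing.map_maximalIdeal_of_surjective πW hπWsurj
    have hfbm : πE f ∈ maximalIdeal B := by
      have hzZ : (redSubι G E hE) y ∈ (((vanishingIdeal (⟨Z, hZ⟩ : Closeds G)) : G.IdealSheafData).support : Set G) := by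
        rw [hz₀, ← Scheme.IdealSheafData.range_subschemeι]; exact ⟨z, rfl⟩
      have hfm : f ∈ maximalIdeal (G.presheaf.stalk ((redSubι G E hE) y)) :=
        (mem_support_iff_stalkIdeal_le _ _).mp hzZ (hf ▸ Ideal.mem_sup_right (Ideal.mem_span_singleton_self f))
      rw [← IsLocalRing.map_maximalIdeal_of_surjective πE hπEsurj]
      exact Ideal.mem_map_of_mem _ hfm
    have hfb2 : πE f ∉ maximalIdeal B ^ 2 := by
      intro h2
      apply hf2
      rw [← IsLocalRing.map_maximalIdeal_of_surjective πE hπEsurj, ← Ideal.map_pow] at h2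
      have h3 := Ideal.mem_comap.mpr h2
      rw [Ideal.comap_map_of_surjective πE hπEsurj, ← RingHom.ker_eq_comap_bot, hkerE, sup_comm] at h3
      exact h3
    have hftm : ft ∈ maximalIdeal A := by
      have : πW ft ∈ maximalIdeal B := hft ▸ hfbm
      have h := Ideal.mem_comap.mpr this
      rwa [← hmapW, Ideal.comap_map_of_surjective πW hπWsurj, ← RingHom.ker_eq_comap_bot, hkerW,
        sup_eq_left.mpr ((Ideal.span_singleton_le_iff_mem _).mpr (ModelSquare.germ_mem_maximalIdeal O θ hθ w jW tW hsqW y ϖ hϖ))] at h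
    have hft2 : ft ∉ maximalIdeal A ^ 2 := by
      intro h
      apply hfb2
      rw [← hft, ← hmapW, ← Ideal.map_pow]
      exact Ideal.mem_map_of_mem _ h
    obtain ⟨hregq, hdimq⟩ := IsRegularLocalRing.quotient_span_singleton hftm hft2
    haveI := hregq
    haveI : IsDomain (A ⧸ Ideal.span {ft}) := isDomain_of_isRegularLocalRing _
    -- `ϖ̃ ∉ (f̃)`: otherwise `𝒪_{Z̃,z} ≅ B ⧸ (f̄) ≅ A ⧸ (f̃)` has dimension `2`, not `1`
    have hϖft : ϖb ∉ Ideal.span {ft} := by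
      intro hmem
      -- `A ⧸ (f̃) ≃ B ⧸ (f̄)` since `ker πW = (ϖ̃) ≤ (f̃)`
      have hker1 : RingHom.ker ((Ideal.Quotient.mk (Ideal.span {πE f})).comp πW) = Ideal.span {ft} := by
        rw [← RingHom.comap_ker, Ideal.mk_ker, ← hft, ← Set.image_singleton (f := πW), ← Ideal.map_span,
          Ideal.comap_map_of_surjective πW hπWsurj, ← RingHom.ker_eq_comap_bot, hkerW]
        exact sup_eq_left.mpr ((Ideal.span_singleton_le_iff_mem _).mpr hmem)
      have e1 : A ⧸ Ideal.span {ft} ≃+* B ⧸ Ideal.span {πE f} :=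
        (Ideal.quotEquivOfEq hker1.symm).trans (RingHom.quotientKerEquivOfSurjective
          (Ideal.Quotient.mk_surjective.comp hπWsurj))
      -- `B ⧸ (f̄) ≃ 𝒪_{Z̃,z}`
      have hkerι : RingHom.ker πι = Ideal.span {πE f} := by
        rw [ker_eq_map_ker_comp_of_surjective πE hπEsurj πι, hkerZ, hf, Ideal.map_sup, ← hkerE, Ideal.map_span, Set.image_singleton,
          (Ideal.map_eq_bot_iff_le_ker πE).mpr le_rfl, bot_sup_eq]
      have e2 : B ⧸ Ideal.span {πE f} ≃+* (redSub G Z hZ).presheaf.stalk z :=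
        (Ideal.quotEquivOfEq hkerι.symm).trans (RingHom.quotientKerEquivOfSurjective hπιsurj)
      have hd : ringKrullDim (A ⧸ Ideal.span {ft}) = ((1 : ℕ) : WithBot ℕ∞) := by
        rw [ringKrullDim_eq_of_ringEquiv (e1.trans e2)]; exact hZdim
      rw [hd, hdimA, hEdim] at hdimq
      exact absurd hdimq (by decide)
    -- the swap: `f̄` is a non-zero-divisor of `B = A ⧸ (ϖ̃)`
    have hϖreg : ∀ b : A, ϖb * b ∈ Ideal.span {ft} → b ∈ Ideal.span {ft} := by
      intro b hb
      have h0 : Ideal.Quotient.mk (Ideal.span {ft}) ϖb * Ideal.Quotient.mk (Ideal.span {ft}) b = 0 := by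
        rw [← map_mul, Ideal.Quotient.eq_zero_iff_mem]; exact hb
      rcases mul_eq_zero.mp h0 with h | h
      · exact absurd (Ideal.Quotient.eq_zero_iff_mem.mp h) hϖft
      · exact Ideal.Quotient.eq_zero_iff_mem.mp h
    have hft0 : ft ≠ 0 := fun h => hft2 (by rw [h]; exact zero_mem _)
    haveI : IsDomain A := isDomain_of_isRegularLocalRing A
    rw [isSMulRegular_iff_right_eq_zero_of_smul]
    intro b hb
    rw [smul_eq_mul] at hb
    obtain ⟨a, rfl⟩ := hπWsurj b
    have hfa : ft * a ∈ Ideal.span {ϖb} := by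
      rw [← hkerW, RingHom.mem_ker, map_mul, hft]; exact hb
    have ha := mem_span_of_mul_mem_span_swap hft0 hϖreg a hfa
    rw [← hkerW] at ha
    exact ha

/-! ## §3 `EmbeddedLiftFact`'s local-complete-intersection clause for `i : Z̃ ⟶ Ẽ` -/

include hθ hsqW in
/-- ★★ **THE lci CLAUSE OF (F) FOR A ONE-PARAMETER CUT OF THE HOST** (W₂ supply brick «(L2)-Cartier»): `G` locally Noetherian and quasi-compact, the
host trace `Ẽ` the special fibre of a REGULAR locally Noetherian `O`-flat model `W` (model square `jW`), `i : Z̃ ⟶ Ẽ` over `G`, (D1) `dim 𝒪_{Z̃,z} = 1` and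
(D2) `dim 𝒪_{Ẽ,i z} = 2` at closed `z`, and the letter (L2) at every closed point of `Z` — then every point of `Z̃` has an affine open neighbourhood `U`
in `Ẽ` on which the ideal of `Z̃` is generated by ONE NON-ZERO-DIVISOR, i.e. by the weakly regular sequence `[j]`: `EmbeddedLiftFact`'s clause VERBATIM
in shape (closed points suffice by generisation; at a closed point ★ gives generator and non-zero-divisor in the stalk, spread to a basic open
neighbourhood by Noetherian finiteness exactly as in ✓ p696215). [folklore; every characteristic] [OURS · W₂ brick (A); counted 0] -/
theorem exists_affineOpens_isWeaklyRegular_ker [IsLocallyNoetherian G] [CompactSpace G] [IsLocallyNoetherian W] [Flat w]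
    (hWreg : Scheme.IsRegular W) (i : redSub G Z hZ ⟶ redSub G E hE) (hi : i ≫ redSubι G E hE = redSubι G Z hZ)
    (hEdim : ∀ z : ↥(redSub G Z hZ), IsClosed ({z} : Set ↥(redSub G Z hZ)) →
      ringKrullDim ((redSub G E hE).presheaf.stalk (i z)) = ((2 : ℕ) : WithBot ℕ∞))
    (hZdim : ∀ z : ↥(redSub G Z hZ), IsClosed ({z} : Set ↥(redSub G Z hZ)) →
      ringKrullDim ((redSub G Z hZ).presheaf.stalk z) = ((1 : ℕ) : WithBot ℕ∞))
    (hL2 : ∀ z ∈ Z, IsClosed ({z} : Set G) → ∃ f : G.presheaf.stalk z,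
      stalkIdeal (vanishingIdeal (⟨Z, hZ⟩ : Closeds G)) z = stalkIdeal (vanishingIdeal (⟨E, hE⟩ : Closeds G)) z ⊔ Ideal.span {f} ∧
        f ∉ stalkIdeal (vanishingIdeal (⟨E, hE⟩ : Closeds G)) z ⊔ maximalIdeal (G.presheaf.stalk z) ^ 2) :
    ∀ z : ↥(redSub G Z hZ), ∃ U : (redSub G E hE).affineOpens, i.base z ∈ (U : (redSub G E hE).Opens) ∧
      ∃ rs : List Γ(redSub G E hE, U), RingTheory.Sequence.IsWeaklyRegular Γ(redSub G E hE, U) rs ∧ Ideal.ofList rs = i.ker.ideal U := by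
  -- adapted from ✓ p696215 `NodalCurve.exists_affineOpens_isWeaklyRegular_ker` (res-L1-w45b-nose-w1 g5)
  classical
  haveI : IsClosedImmersion (i ≫ redSubι G E hE) := by rw [hi]; infer_instance
  haveI : IsClosedImmersion i := IsClosedImmersion.of_comp_isClosedImmersion i (redSubι G E hE)
  haveI : IsLocallyNoetherian (redSub G E hE) := LocallyOfFiniteType.isLocallyNoetherian (redSubι G E hE)
  -- closed points suffice
  haveI : CompactSpace ↥(redSub G Z hZ) := QuasiCompact.compactSpace_of_compactSpace (redSubι G Z hZ)
  suffices hcl : ∀ z₀ : ↥(redSub G Z hZ), IsClosed ({z₀} : Set ↥(redSub G Z hZ)) →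
      ∃ U : (redSub G E hE).affineOpens, i.base z₀ ∈ (U : (redSub G E hE).Opens) ∧
        ∃ rs : List Γ(redSub G E hE, U), RingTheory.Sequence.IsWeaklyRegular Γ(redSub G E hE, U) rs ∧ Ideal.ofList rs = i.ker.ideal U by
    intro z
    obtain ⟨z₀, hz₀, hcl₀⟩ := (isClosed_closure (s := ({z} : Set ↥(redSub G Z hZ)))).exists_closed_singleton ⟨z, subset_closure rfl⟩
    have hzz₀ : z ⤳ z₀ := specializes_iff_mem_closure.mpr hz₀
    obtain ⟨U, hU, rs, hrs⟩ := hcl z₀ hcl₀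
    exact ⟨U, (hzz₀.map i.continuous).mem_open U.1.isOpen hU, rs, hrs⟩
  intro z₀ hz₀
  -- ★ at the closed point: generator `f ∈ 𝔪 ∖ 𝔪²`, a non-zero-divisor
  have hzZ : ((redSubι G Z hZ) z₀ : G) ∈ Z := by
    have h : ((redSubι G Z hZ) z₀ : G) ∈ ((vanishingIdeal (⟨Z, hZ⟩ : Closeds G)).support : Set G) := by
      rw [← Scheme.IdealSheafData.range_subschemeι]; exact ⟨z₀, rfl⟩
    rwa [Scheme.IdealSheafData.coe_support_vanishingIdeal] at h
  have hzc : IsClosed ({(redSubι G Z hZ) z₀} : Set G) := by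
    simpa only [Set.image_singleton] using (redSubι G Z hZ).isClosedEmbedding.isClosedMap _ hz₀
  obtain ⟨f, hf, -, hf2, hfreg⟩ := ker_stalkMap_eq_span_and_isSMulRegular O θ hθ hZ hE w jW tW hsqW hWreg i hi z₀ (hZdim z₀ hz₀)
    (hEdim z₀ hz₀) (hL2 _ hzZ hzc)
  have hf0 : f ≠ 0 := fun h => hf2 (h ▸ zero_mem _)
  have hf' : stalkIdeal i.ker (i z₀) = Ideal.span {f} := (stalkIdeal_ker_eq_ker_stalkMap i z₀).trans hf
  -- an affine open neighbourhood `U₀`, its (Noetherian) ring `R`, the prime `𝔮` of `i z₀`, and the stalk as `R_𝔮`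
  obtain ⟨U₀, hU₀, hxU₀, -⟩ := exists_isAffineOpen_mem_and_subset (X := redSub G E hE) (x := i z₀) (U := ⊤) (Opens.mem_top _)
  letI := TopCat.Presheaf.algebra_section_stalk (redSub G E hE).presheaf (⟨i z₀, hxU₀⟩ : (U₀ : (redSub G E hE).Opens))
  haveI := hU₀.isLocalization_stalk ⟨i z₀, hxU₀⟩
  set 𝔮 := (hU₀.primeIdealOf ⟨i z₀, hxU₀⟩).asIdeal with h𝔮
  set J : Ideal Γ(redSub G E hE, U₀) := i.ker.ideal ⟨U₀, hU₀⟩ with hJ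
  -- the stalk ideal is `J · R_𝔮 = (f)`; pick `j ∈ J` whose germ generates it — it is then a non-zero-divisor too
  have hJf : J.map (algebraMap Γ(redSub G E hE, U₀) ((redSub G E hE).presheaf.stalk (i z₀))) = Ideal.span {f} := by
    rw [← hf', stalkIdeal_eq_map_germ i.ker ⟨U₀, hU₀⟩ hxU₀]; rfl
  obtain ⟨s, ⟨j, hjJ, rfl⟩, hsj⟩ := NodalCurve.exists_mem_span_singleton_eq
    (S := ⇑(algebraMap Γ(redSub G E hE, U₀) ((redSub G E hE).presheaf.stalk (i z₀))) '' (J : Set Γ(redSub G E hE, U₀))) hf0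
    (by rw [← hJf]; rfl)
  have hjJ' : j ∈ J := hjJ
  have hjreg : IsSMulRegular ((redSub G E hE).presheaf.stalk (i z₀)) (algebraMap Γ(redSub G E hE, U₀) ((redSub G E hE).presheaf.stalk (i z₀)) j) :=
    isSMulRegular_of_span_singleton_eq hfreg hsj
  -- spread the generator: `g₁ ∉ 𝔮` with `g₁ x ∈ jR` for `x ∈ J`
  have hJle : J.map (algebraMap Γ(redSub G E hE, U₀) ((redSub G E hE).presheaf.stalk (i z₀))) ≤
      Ideal.span {algebraMap Γ(redSub G E hE, U₀) ((redSub G E hE).presheaf.stalk (i z₀)) j} := by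
    rw [hJf, ← hsj]
  haveI : IsNoetherianRing Γ(redSub G E hE, U₀) := IsLocallyNoetherian.component_noetherian ⟨U₀, hU₀⟩
  obtain ⟨g₁, hg₁, H₁⟩ := Literature.RingTheory.UniqueFactorizationDomain.exists_notMem_forall_mul_mem_of_fg (q := 𝔮)
    (IsNoetherian.noetherian J) (Literature.RingTheory.UniqueFactorizationDomain.exists_mul_eq_of_map_le_span hJle)
  -- spread the non-zero-divisor: `g₂ ∉ 𝔮` killing the annihilator of `j`
  obtain ⟨g₂, hg₂, H₂⟩ := exists_notMem_forall_mul_eq_zero_of_isSMulRegular 𝔮 (A := (redSub G E hE).presheaf.stalk (i z₀)) hjreg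
  -- the basic open `D(g₁ g₂) ∋ i z₀`
  have hgq : g₁ * g₂ ∉ 𝔮 := fun h => ((inferInstance : 𝔮.IsPrime).mem_or_mem h).elim hg₁ hg₂
  have hxg : (i z₀ : ↥(redSub G E hE)) ∈ (redSub G E hE).basicOpen (g₁ * g₂) := by
    rw [(redSub G E hE).mem_basicOpen (g₁ * g₂) (i z₀) hxU₀]
    exact (IsLocalization.AtPrime.isUnit_to_map_iff ((redSub G E hE).presheaf.stalk (i z₀)) 𝔮 (g₁ * g₂)).mpr hgq
  haveI := hU₀.isLocalization_basicOpen (g₁ * g₂)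
  refine ⟨(redSub G E hE).affineBasicOpen (U := ⟨U₀, hU₀⟩) (g₁ * g₂), hxg,
    [algebraMap Γ(redSub G E hE, U₀) Γ(redSub G E hE, (redSub G E hE).basicOpen (g₁ * g₂)) j], ?_, ?_⟩
  · -- `[j]` is weakly regular on `Γ(D(g₁ g₂))`: `j` is a non-zero-divisor there
    show RingTheory.Sequence.IsWeaklyRegular Γ(redSub G E hE, (redSub G E hE).basicOpen (g₁ * g₂))
      [algebraMap Γ(redSub G E hE, U₀) Γ(redSub G E hE, (redSub G E hE).basicOpen (g₁ * g₂)) j]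
    rw [RingTheory.Sequence.isWeaklyRegular_singleton_iff]
    exact NodalCurve.isSMulRegular_algebraMap_of_away (g := g₁ * g₂) (fun a ha => by rw [mul_assoc, H₂ a ha, mul_zero])
  · -- `(ker i)(D(g₁ g₂)) = J · Γ(D(g₁ g₂)) = (j)`
    have hunit : IsUnit (algebraMap Γ(redSub G E hE, U₀) Γ(redSub G E hE, (redSub G E hE).basicOpen (g₁ * g₂)) (g₁ * g₂)) :=
      IsLocalization.Away.algebraMap_isUnit (g₁ * g₂)
    have hmap := NodalCurve.map_eq_span_singleton_of_forall_mul_eq hjJ' (fun x hx => by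
      obtain ⟨a, ha⟩ := H₁ x hx
      exact ⟨g₂ * a, by rw [mul_assoc, mul_comm g₂ x, ← mul_assoc, ha]; ring⟩) hunit
    have h3 := i.ker.map_ideal_basicOpen ⟨U₀, hU₀⟩ (g₁ * g₂)
    show Ideal.ofList [algebraMap Γ(redSub G E hE, U₀) Γ(redSub G E hE, (redSub G E hE).basicOpen (g₁ * g₂)) j] =
      i.ker.ideal ((redSub G E hE).affineBasicOpen (U := ⟨U₀, hU₀⟩) (g₁ * g₂))
    rw [Ideal.ofList_singleton]
    exact hmap.symm.trans h3

end Stalk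

end Summit.ResolutionOfSingularities.ResolutionOfSingularities.Cruxes.EquisingularLiftNat.Sections.SecCurve

end
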